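import Literature.AnabelianGeometry.EtaleTheta.ContH1CoeffChange
import Literature.AnabelianGeometry.EtaleTheta.ContH1Lemmas
import Literature.AnabelianGeometry.SemiGraphs.TemperedCompletionOpenSubgroups
import Mathlib.Topology.Algebra.ClopenNhdofOne
import Mathlib.Topology.DenseEmbedding
import HarnessLib

/-!
# [EtTh] Remark 1.6.4: continuous `H¹` is carried bijectively along a profinite completion
# («determines, by profinite completion») — proof-only

Mochizuki, *The étale theta function and its Frobenioid-theoretic manifestations*, Publ. RIMS **45**
(2009) [EtTh], Remark 1.6.4 p. 252: "if we denote by `(Ÿ^log)^∧ → (Y^log)^∧ → X^log` the profinite étale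
coverings determined by the tempered coverings `Ÿ^log → Y^log → X^log` …, then the set of classes
`O^×_K̈ · η̈^Θ ∈ H¹(Π^tp_Ÿ, Δ_Θ)` determines, by profinite completion, a set of classes
`O^×_K̈ · (η̈^Θ)^∧ ∈ H¹(Π_{Ÿ^∧}, Δ_Θ)`" [cite: MochizukiEtTh2009, Rmk 1.6.4 p.252]; the cohomology is the
continuous `H¹` by crossed homomorphisms of Neukirch–Schmidt–Wingberg, *Cohomology of Number Fields*,
I §2 / II §7 [cite: NeukirchSchmidtWingberg2008, I §2 and II §7], typed in the tree as
`ContH1 φ A H` (`ContH1.lean`, abc-iut-L2-t1) with the pull-back `ContH1.comap` along a continuous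
homomorphism (`ContH1CoeffChange.lean`).

PROOF-ONLY (abc-iut cell, prover abc-iut-f-128 gen 8; VNEXT row «RMK164-PROFINITE-TWIN», piece D3(b)
of the sizing memo `staging/f/f-128/g7/SIZING-Rmk164-ProfiniteTwin-f128-g7.md`; no definitions, no
facts).  THE GENERIC COMPARISON THEOREM behind "determines, by profinite completion": let
`κ : G → Ĝ` be a continuous homomorphism of topological groups, `H ≤ G`, `Ĥ ≤ Ĝ` with `κ(H) ≤ Ĥ`,
`φ : Ĝ → Ĝ′` continuous, and `A ≤ Ĝ′` an abelian normal subgroup (coefficients, acted on by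
conjugation through `φ`, resp. through `φ ∘ κ` on the `G`-side).  Then for the pull-back
`κ^* : H¹(Ĥ, A) → H¹(H, A)` (`ContH1.comap φ A κ _ _`):

* `ContH1.comap_injective_of_dense` — if `κ(H)` is DENSE in `Ĥ` and `Ĝ′` is Hausdorff, `κ^*` is
  injective (a cocycle on `Ĥ` whose pull-back is the coboundary of `a` IS the coboundary of `a`: two
  continuous maps agreeing on a dense set);
* `ContH1.comap_surjective_of_isProfiniteCompletion` — if the co-restriction `κ_H : H → Ĥ` is a
  PROFINITE COMPLETION ([SemiAnbd] §6 `IsProfiniteCompletion`, [cite: MochizukiSemiAnbd2006, §6 p.69]),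
  `Ĝ′` is profinite (compact, Hausdorff, totally disconnected) and `A` is closed, `κ^*` is surjective:
  every continuous cocycle `c : H → A` EXTENDS to a continuous cocycle on `Ĥ`.  Proof: for each open
  normal `N ⊴ Ĝ′` the set `{y ∈ H | c(y) ∈ N}` is an open subgroup of finite index of `H` (cocycle
  identity; `c` continuous; `H/S ↪ Ĝ′/N`), hence contains `κ_H⁻¹(V)` for an open normal `V ⊴ Ĥ`
  (`IsProfiniteCompletion.exists_openNormal_le`), i.e. `κ_H(y)⁻¹κ_H(y′) ∈ V ⟹ c(y)⁻¹c(y′) ∈ N`; so the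
  closure of the graph `{(κ_H y, c y)}` in the compact space `Ĥ × A` is the graph of a FUNCTION `ĉ`
  (single-valued because the open normal subgroups of `Ĝ′` meet in `1`), defined everywhere (dense
  range), continuous (closed graph into a compact Hausdorff space), extending `c`, and a cocycle
  (the identity holds on the dense `κ_H(H) × κ_H(H)`);
* `ContH1.comap_bijective_of_isProfiniteCompletion` — both.
The hypothesis «`κ_H` is a profinite completion» is DISPLAYED, never assumed for free: it holds for
`Π^tp_X → Π̂_X` itself (`TemperedCurve.isProfiniteCompletion_toHat`), and for a co-restriction to a
subgroup exactly under the cofinality criterion `IsProfiniteCompletion.restrict_iff_cofinal`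
(`Discharge/Sec1Rmk164ProfiniteCompletionRestrictCofinal.lean`), which can FAIL for infinite-index
subgroups (the no-go at `ker(F₂ ↠ ℤ) ≤ F₂` of the companion `…RestrictNoGo` file); for [EtTh]
Rmk. 1.6.4 the classes in question arise from the Θ-quotient (Prop. 1.5 (iii) p. 23, `inflTheta`),
where the relevant image of `Π^tp_Ÿ` is already compact (spec v2 of the VNEXT row), and the [EtTh]
instance is NOT instantiated here; the identification of the `G`-side coefficients with the tempered
`Δ_Θ` is `ContH1.actionCongr` bookkeeping.  Classical; Mathlib + the cited tree files only; nothing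
here bears on [IUTchIII] Cor. 3.12; typed ≠ proved.
-/

noncomputable section

namespace Literature.AnabelianGeometry.EtaleTheta

open scoped IsMulCommutative
open Topology
open Literature.AnabelianGeometry.SemiGraphs

namespace ContH1

variable {G Gh Gh' : Type*} [Group G] [TopologicalSpace G] [IsTopologicalGroup G]
  [Group Gh] [TopologicalSpace Gh] [IsTopologicalGroup Gh]
  [Group Gh'] [TopologicalSpace Gh'] [IsTopologicalGroup Gh']

/-! ### Two elementary cocycle computations -/

omit [IsTopologicalGroup Gh'] in
/-- Conjugation `x ↦ g(x) b g(x)⁻¹` of a FIXED `b ∈ B ⊴ Ĝ′` by a continuously varying `g(x)` is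
continuous into `B`. [folklore] -/
private theorem continuous_conjNormal_left [ContinuousMul Gh'] [ContinuousInv Gh']
    {B : Subgroup Gh'} [B.Normal] (b : B) {X : Type*} [TopologicalSpace X] {g : X → Gh'}
    (hg : Continuous g) : Continuous fun x => MulAut.conjNormal (g x) b := by
  refine continuous_induced_rng.2 ?_
  have : (Subtype.val ∘ fun x => MulAut.conjNormal (g x) b) = fun x => g x * (b : Gh') * (g x)⁻¹ := by
    funext x
    simp [MulAut.conjNormal_apply]
  rw [this]
  fun_prop

omit [TopologicalSpace Gh'] [IsTopologicalGroup Gh'] [IsTopologicalGroup G] in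
/-- For a cocycle `c` (action through `ψ`): `c(y⁻¹y′) = ψ(y)⁻¹ · (c(y)⁻¹ c(y′)) · ψ(y)` in the
ambient group — so `c(y⁻¹y′)` lies in a normal subgroup iff `c(y)⁻¹c(y′)` does.
[cite: NeukirchSchmidtWingberg2008, I §2 and II §7] -/
private theorem coe_map_inv_mul [TopologicalSpace Gh'] [IsTopologicalGroup Gh'] {ψ : G →* Gh'}
    {A : Subgroup Gh'} [A.Normal] [IsMulCommutative A] {H : Subgroup G}
    (c : contCocycles ψ A H) (y y' : H) :
    ((c.1 (y⁻¹ * y') : A) : Gh') =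
      (ψ (y : G))⁻¹ * (((c.1 y : A) : Gh')⁻¹ * ((c.1 y' : A) : Gh')) * ψ (y : G) := by
  have h1 : c.1 (y⁻¹ * y') = c.1 y⁻¹ * MulAut.conjNormal (ψ ((y⁻¹ : H) : G)) (c.1 y') := c.2.2 y⁻¹ y'
  have h2 : c.1 y⁻¹ = MulAut.conjNormal (ψ ((y⁻¹ : H) : G)) (c.1 y)⁻¹ := by
    have h := conjNormal_apply_map_inv c y
    -- `conj(ψ y) (c y⁻¹) = (c y)⁻¹`; apply `conj(ψ y⁻¹)` to both sides
    have h' := congrArg (MulAut.conjNormal (ψ ((y⁻¹ : H) : G))) h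
    rw [← MulAut.mul_apply, ← map_mul, Subgroup.coe_inv, map_inv, inv_mul_cancel, map_one,
      MulAut.one_apply] at h'
    rw [h', ← map_inv, ← Subgroup.coe_inv]
  rw [h1, h2, ← map_mul]
  simp only [Subgroup.coe_inv, map_inv, MulAut.conjNormal_inv_apply, Subgroup.coe_mul, mul_assoc]

/-! ### Injectivity: dense image suffices -/

omit [IsTopologicalGroup G] [IsTopologicalGroup Gh] in
/-- **Pull-back of continuous `H¹` along a homomorphism with dense image is injective.**  For
`κ : G → Ĝ` continuous with `κ(H) ≤ Ĥ` and `κ(H)` DENSE in `Ĥ`, coefficients `A ⊴ Ĝ′` (abelian, `Ĝ′`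
Hausdorff) acted on through a continuous `φ : Ĝ → Ĝ′`: the pull-back
`ContH1.comap : H¹(Ĥ, A) → H¹(H, A)` is injective — a continuous cocycle on `Ĥ` that pulls back to the
coboundary of `a` coincides with the coboundary of `a` on the dense `κ(H)`, hence everywhere.
(The injectivity half of "determines, by profinite completion", [EtTh] Rmk. 1.6.4.)
[cite: MochizukiEtTh2009, Rmk 1.6.4 p.252] [cite: NeukirchSchmidtWingberg2008, I §2 and II §7] -/
theorem comap_injective_of_dense [T2Space Gh'] (φ : Gh →* Gh') (hφ : Continuous φ)
    (A : Subgroup Gh') [A.Normal] [IsMulCommutative A] (κ : G →* Gh) (hκ : Continuous κ)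
    {H : Subgroup G} {Hh : Subgroup Gh} (h : H.map κ ≤ Hh)
    (hd : Dense ((Subtype.val : Hh → Gh) ⁻¹' (κ '' (H : Set G)))) :
    Function.Injective (ContH1.comap φ A κ hκ h) := by
  rw [injective_iff_map_eq_one]
  intro x hx
  induction x using QuotientGroup.induction_on with
  | H f =>
    have hx' : ContH1.comapCocycle φ A κ hκ h f ∈
        (contCoboundaries (φ.comp κ) A H).subgroupOf (contCocycles (φ.comp κ) A H) := by
      rw [← QuotientGroup.eq_one_iff]
      exact hx
    obtain ⟨a, ha⟩ := (mem_contCoboundaries_iff _).mp (Subgroup.mem_subgroupOf.mp hx')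
    refine (QuotientGroup.eq_one_iff _).mpr
      (Subgroup.mem_subgroupOf.mpr ((mem_contCoboundaries_iff _).mpr ⟨a, ?_⟩))
    -- two continuous maps `Ĥ → A` agreeing on the dense `κ(H)`
    have hcont : Continuous fun z : Hh => MulAut.conjNormal (φ (z : Gh)) a * a⁻¹ :=
      (continuous_conjNormal_left a (hφ.comp continuous_subtype_val)).mul continuous_const
    refine Continuous.ext_on hd f.2.1 hcont ?_
    rintro z ⟨y, hy, hyz⟩
    have hz : (⟨κ y, h ⟨y, hy, rfl⟩⟩ : Hh) = z := Subtype.ext hyz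
    have := congrFun ha ⟨y, hy⟩
    rw [← hz]
    simpa [ContH1.comapCocycle] using this

/-! ### Surjectivity: extension of continuous cocycles to the profinite completion -/

section Surjective

variable [CompactSpace Gh'] [T2Space Gh'] [TotallyDisconnectedSpace Gh']
  {φ : Gh →* Gh'} {A : Subgroup Gh'} [A.Normal] [IsMulCommutative A]
  {κ : G →* Gh} {H : Subgroup G} {Hh : Subgroup Gh}
  {κH : H →ₜ* Hh}

omit [T2Space Gh'] [TotallyDisconnectedSpace Gh'] in
/-- **The level lemma.**  For a continuous cocycle `c : H → A` (action through `φ ∘ κ`) and an open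
normal `N ⊴ Ĝ′`: if `κ_H : H → Ĥ` is a profinite completion, there is an open normal `V ⊴ Ĥ` with
`κ_H(y)⁻¹ κ_H(y′) ∈ V ⟹ c(y)⁻¹ c(y′) ∈ N` — because `S := {y | c(y) ∈ N}` is an open subgroup of finite
index of `H` (`H/S ↪ Ĝ′/N`), so contains `κ_H⁻¹(V)` for some `V`
(`IsProfiniteCompletion.exists_openNormal_le`). [cite: MochizukiSemiAnbd2006, §6 p.69]
[cite: NeukirchSchmidtWingberg2008, I §2 and II §7] -/
theorem exists_openNormal_level (hc : IsProfiniteCompletion κH)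
    (c : contCocycles (φ.comp κ) A H) (N : OpenNormalSubgroup Gh') :
    ∃ V : OpenNormalSubgroup Hh, ∀ y y' : H, (κH y)⁻¹ * κH y' ∈ V.toSubgroup →
      (((c.1 y : A) : Gh'))⁻¹ * ((c.1 y' : A) : Gh') ∈ N.toSubgroup := by
  classical
  -- the level subgroup `S = {y | c y ∈ N}`
  let S : Subgroup H :=
    { carrier := {y | ((c.1 y : A) : Gh') ∈ N.toSubgroup}
      one_mem' := by
        show ((c.1 1 : A) : Gh') ∈ N.toSubgroup
        rw [cocycle_map_one c]
        exact N.toSubgroup.one_mem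
      mul_mem' := by
        intro y y' hy hy'
        show ((c.1 (y * y') : A) : Gh') ∈ N.toSubgroup
        rw [c.2.2 y y', Subgroup.coe_mul, MulAut.conjNormal_apply]
        exact N.toSubgroup.mul_mem hy (N.isNormal'.conj_mem _ hy' _)
      inv_mem' := by
        intro y hy
        show ((c.1 y⁻¹ : A) : Gh') ∈ N.toSubgroup
        have := coe_map_inv_mul c y 1
        rw [mul_one] at this
        rw [this, cocycle_map_one c, OneMemClass.coe_one, mul_one]
        have h1 : (((c.1 y : A) : Gh'))⁻¹ ∈ N.toSubgroup := N.toSubgroup.inv_mem hy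
        simpa only [inv_inv] using N.isNormal'.conj_mem _ h1 (((φ.comp κ) (y : G))⁻¹) }
  have hSmem : ∀ y : H, y ∈ S ↔ ((c.1 y : A) : Gh') ∈ N.toSubgroup := fun y => Iff.rfl
  -- `y⁻¹ y' ∈ S ↔ c(y)⁻¹ c(y') ∈ N`
  have hS_iff : ∀ y y' : H,
      y⁻¹ * y' ∈ S ↔ (((c.1 y : A) : Gh'))⁻¹ * ((c.1 y' : A) : Gh') ∈ N.toSubgroup := by
    intro y y'
    rw [hSmem, coe_map_inv_mul c y y']
    constructor
    · intro hmem
      have := N.isNormal'.conj_mem _ hmem ((φ.comp κ) (y : G))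
      simpa only [mul_assoc, mul_inv_cancel, mul_one, mul_inv_cancel_left] using this
    · intro hmem
      have := N.isNormal'.conj_mem _ hmem (((φ.comp κ) (y : G))⁻¹)
      simpa only [inv_inv] using this
  -- `S` is open
  have hSo : IsOpen (S : Set H) := by
    have hcont : Continuous fun y : H => ((c.1 y : A) : Gh') := continuous_subtype_val.comp c.2.1
    exact N.toOpenSubgroup.isOpen.preimage hcont
  -- `S` has finite index: `H/S ↪ Ĝ′/N`, a finite set
  haveI : Finite (Gh' ⧸ N.toSubgroup) := Subgroup.quotient_finite_of_isOpen _ N.toOpenSubgroup.isOpen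
  haveI : Finite (H ⧸ S) := by
    refine Finite.of_injective
      (fun q : H ⧸ S => Quotient.liftOn' q
        (fun y : H => (QuotientGroup.mk (((c.1 y : A) : Gh')) : Gh' ⧸ N.toSubgroup))
        (fun y y' hyy' => QuotientGroup.eq.mpr ((hS_iff y y').mp (QuotientGroup.leftRel_apply.mp hyy'))))
      ?_
    intro q q' hqq'
    induction q using Quotient.inductionOn' with
    | h y =>
      induction q' using Quotient.inductionOn' with
      | h y' =>
        have hN : (((c.1 y : A) : Gh'))⁻¹ * ((c.1 y' : A) : Gh') ∈ N.toSubgroup :=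
          QuotientGroup.eq.mp hqq'
        exact Quotient.sound' (QuotientGroup.leftRel_apply.mpr ((hS_iff y y').mpr hN))
  haveI : S.FiniteIndex := Subgroup.finiteIndex_of_finite_quotient
  -- an open normal `V ⊴ Ĥ` with `κ_H⁻¹(V) ≤ S`
  obtain ⟨V, hVS, -⟩ := IsProfiniteCompletion.exists_openNormal_le hc S hSo
  refine ⟨V, fun y y' hyy' => (hS_iff y y').mp (hVS ?_)⟩
  rw [Subgroup.mem_comap]
  change κH (y⁻¹ * y') ∈ V.toSubgroup
  rwa [map_mul, map_inv]

omit [IsTopologicalGroup G] [IsTopologicalGroup Gh] [T2Space Gh'] in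
/-- An element of a profinite group lying in every open normal subgroup is trivial. [folklore] -/
private theorem eq_one_of_forall_openNormal_mem
    (g : Gh') (hg : ∀ N : OpenNormalSubgroup Gh', g ∈ N.toSubgroup) : g = 1 := by
  by_contra hne
  obtain ⟨N, hN⟩ := ProfiniteGrp.exist_openNormalSubgroup_sub_open_nhds_of_one
    (isOpen_compl_singleton (x := g)) (show (1 : Gh') ∈ ({g}ᶜ : Set Gh') from fun h1 => hne h1.symm)
  exact hN (hg N) rfl

/-- **Extension of continuous cocycles to the profinite completion.**  If `κ_H : H → Ĥ` (the
co-restriction of a continuous `κ : G → Ĝ` with `κ(H) ≤ Ĥ`) is a profinite completion, `φ : Ĝ → Ĝ′`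
is continuous into a profinite `Ĝ′`, and `A ⊴ Ĝ′` is a closed abelian normal subgroup, then every
continuous cocycle `c : H → A` (action through `φ ∘ κ`) is the pull-back of a continuous cocycle
`ĉ : Ĥ → A` (action through `φ`): `ĉ(κ_H y) = c(y)`.  `ĉ` is the function whose graph is the closure
of `{(κ_H y, c y)}` in `Ĥ × A`. [cite: MochizukiEtTh2009, Rmk 1.6.4 p.252]
[cite: NeukirchSchmidtWingberg2008, I §2 and II §7] -/
theorem exists_cocycle_extension (hφ : Continuous φ) (hA : IsClosed (A : Set Gh'))
    (hκH : ∀ y : H, ((κH y : Hh) : Gh) = κ (y : G))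
    (hc : IsProfiniteCompletion κH) (c : contCocycles (φ.comp κ) A H) :
    ∃ ch : contCocycles φ A Hh, ∀ y : H, ch.1 (κH y) = c.1 y := by
  classical
  haveI : CompactSpace Hh := hc.compactSpace
  haveI : T2Space Hh := hc.t2Space
  haveI : CompactSpace A := isCompact_iff_compactSpace.mp hA.isCompact
  -- the graph of `c` transported to `Ĥ × A`, and its closure
  set Γ : Set (Hh × A) := Set.range fun y : H => (κH y, c.1 y) with hΓdef
  have hΓc : IsCompact (closure Γ) := isClosed_closure.isCompact
  -- (1) every `x ∈ Ĥ` has a companion: `fst '' closure Γ = univ`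
  have hB1 : ∀ x : Hh, ∃ a : A, (x, a) ∈ closure Γ := by
    intro x
    have hcl : IsClosed (Prod.fst '' closure Γ) := (hΓc.image continuous_fst).isClosed
    have hsub : Set.range κH ⊆ Prod.fst '' closure Γ := by
      rintro _ ⟨y, rfl⟩
      exact ⟨(κH y, c.1 y), subset_closure ⟨y, rfl⟩, rfl⟩
    have huniv : (Set.univ : Set Hh) ⊆ Prod.fst '' closure Γ := by
      rw [← hc.denseRange.closure_range]
      exact hcl.closure_subset_iff.mpr hsub
    obtain ⟨⟨x', a⟩, hmem, hx'⟩ := huniv (Set.mem_univ x)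
    exact ⟨a, by simpa [← hx'] using hmem⟩
  -- (2) the closure is single-valued
  have hB2 : ∀ (x : Hh) (a b : A), (x, a) ∈ closure Γ → (x, b) ∈ closure Γ → a = b := by
    intro x a b ha hb
    have hall : ∀ N : OpenNormalSubgroup Gh', ((a : Gh'))⁻¹ * (b : Gh') ∈ N.toSubgroup := by
      intro N
      obtain ⟨V, hV⟩ := exists_openNormal_level hc c N
      -- the open neighbourhood `x·V × u·N` of `(x, u)` meets `Γ`
      have hnbhd : ∀ u : A, (x, u) ∈ closure Γ → ∃ y : H, x⁻¹ * κH y ∈ V.toSubgroup ∧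
          ((u : Gh'))⁻¹ * ((c.1 y : A) : Gh') ∈ N.toSubgroup := by
        intro u hu
        have hO : IsOpen {p : Hh × A | x⁻¹ * p.1 ∈ V.toSubgroup ∧
            ((u : Gh'))⁻¹ * ((p.2 : A) : Gh') ∈ N.toSubgroup} := by
          refine IsOpen.inter ?_ ?_
          · exact V.toOpenSubgroup.isOpen.preimage (by fun_prop)
          · exact N.toOpenSubgroup.isOpen.preimage (by fun_prop)
        obtain ⟨p, hpO, ⟨y, rfl⟩⟩ := mem_closure_iff.mp hu _ hO
          ⟨by simp, by simp⟩
        exact ⟨y, hpO.1, hpO.2⟩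
      obtain ⟨y, hyV, hyN⟩ := hnbhd a ha
      obtain ⟨y', hy'V, hy'N⟩ := hnbhd b hb
      have hyy' : (κH y)⁻¹ * κH y' ∈ V.toSubgroup := by
        have := V.toSubgroup.mul_mem (V.toSubgroup.inv_mem hyV) hy'V
        simpa only [mul_inv_rev, inv_inv, mul_assoc, mul_inv_cancel_left] using this
      have hcc : (((c.1 y : A) : Gh'))⁻¹ * ((c.1 y' : A) : Gh') ∈ N.toSubgroup := hV y y' hyy'
      have hb' : (((c.1 y' : A) : Gh'))⁻¹ * (b : Gh') ∈ N.toSubgroup := by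
        have := N.toSubgroup.inv_mem hy'N
        simpa only [mul_inv_rev, inv_inv] using this
      have := N.toSubgroup.mul_mem (N.toSubgroup.mul_mem hyN hcc) hb'
      simpa only [mul_assoc, mul_inv_cancel_left] using this
    have key : ((a : Gh'))⁻¹ * (b : Gh') = 1 := eq_one_of_forall_openNormal_mem _ hall
    exact Subtype.ext (inv_mul_eq_one.mp key)
  -- (3) the extension `ĉ`
  choose ch hch using hB1
  have hgraph : ∀ (x : Hh) (a : A), (x, a) ∈ closure Γ ↔ a = ch x :=
    fun x a => ⟨fun hxa => hB2 x a (ch x) hxa (hch x), fun hax => hax ▸ hch x⟩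
  -- (4) `ĉ` extends `c`
  have hext : ∀ y : H, ch (κH y) = c.1 y :=
    fun y => ((hgraph (κH y) (c.1 y)).mp (subset_closure ⟨y, rfl⟩)).symm
  -- (5) `ĉ` is continuous: closed graph into a compact Hausdorff space
  have hcont : Continuous ch := by
    rw [continuous_iff_isClosed]
    intro C hC
    have hpre : ch ⁻¹' C = Prod.fst '' (closure Γ ∩ Prod.snd ⁻¹' C) := by
      ext x
      constructor
      · intro hx
        exact ⟨(x, ch x), ⟨hch x, hx⟩, rfl⟩
      · rintro ⟨⟨x', a⟩, ⟨hxa, haC⟩, rfl⟩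
        have : a = ch x' := (hgraph x' a).mp hxa
        show ch x' ∈ C
        rwa [← this]
    rw [hpre]
    exact ((hΓc.inter_right (hC.preimage continuous_snd)).image continuous_fst).isClosed
  -- (6) `ĉ` is a cocycle: the identity holds on the dense `κ_H(H) × κ_H(H)`
  have hcocycle : ∀ x x' : Hh, ch (x * x') = ch x * MulAut.conjNormal (φ (x : Gh)) (ch x') := by
    have hd2 : DenseRange (Prod.map κH κH) := hc.denseRange.prodMap hc.denseRange
    have hg₁ : Continuous fun p : Hh × Hh => ((ch (p.1 * p.2) : A) : Gh') :=
      continuous_subtype_val.comp (hcont.comp (continuous_fst.mul continuous_snd))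
    have hg₂ : Continuous fun p : Hh × Hh =>
        ((ch p.1 : A) : Gh') * ((MulAut.conjNormal (φ (p.1 : Gh)) (ch p.2) : A) : Gh') := by
      refine (continuous_subtype_val.comp (hcont.comp continuous_fst)).mul ?_
      have : (fun p : Hh × Hh => ((MulAut.conjNormal (φ (p.1 : Gh)) (ch p.2) : A) : Gh')) =
          fun p => φ (p.1 : Gh) * ((ch p.2 : A) : Gh') * (φ (p.1 : Gh))⁻¹ := by
        funext p
        simp [MulAut.conjNormal_apply]
      rw [this]
      have h1 : Continuous fun p : Hh × Hh => φ ((p.1 : Hh) : Gh) :=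
        hφ.comp (continuous_subtype_val.comp continuous_fst)
      have h2 : Continuous fun p : Hh × Hh => ((ch p.2 : A) : Gh') :=
        continuous_subtype_val.comp (hcont.comp continuous_snd)
      fun_prop
    have heq := hd2.equalizer hg₁ hg₂ (by
      funext p
      obtain ⟨y, y'⟩ := p
      simp only [Function.comp_apply, Prod.map_apply]
      rw [← map_mul, hext, hext, hext, c.2.2 y y', Subgroup.coe_mul]
      simp only [MulAut.conjNormal_apply, MonoidHom.coe_comp, Function.comp_apply, hκH])
    intro x x'
    have := congrFun heq (x, x')
    simp only at this
    exact Subtype.ext (by rw [this, Subgroup.coe_mul])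
  exact ⟨⟨ch, hcont, hcocycle⟩, hext⟩

/-- **Pull-back of continuous `H¹` along a profinite completion is surjective** (profinite
coefficients).  With `κ_H : H → Ĥ` a profinite completion, `φ : Ĝ → Ĝ′` continuous into a profinite
`Ĝ′` and `A ⊴ Ĝ′` closed abelian normal, `ContH1.comap φ A κ : H¹(Ĥ, A) → H¹(H, A)` is surjective
(`exists_cocycle_extension`).  The surjectivity half of "determines, by profinite completion",
[EtTh] Rmk. 1.6.4. [cite: MochizukiEtTh2009, Rmk 1.6.4 p.252]
[cite: NeukirchSchmidtWingberg2008, I §2 and II §7] -/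
theorem comap_surjective_of_isProfiniteCompletion (hφ : Continuous φ) (hA : IsClosed (A : Set Gh'))
    (hκ : Continuous κ) (h : H.map κ ≤ Hh) (hκH : ∀ y : H, ((κH y : Hh) : Gh) = κ (y : G))
    (hc : IsProfiniteCompletion κH) :
    Function.Surjective (ContH1.comap φ A κ hκ h) := by
  intro x
  induction x using QuotientGroup.induction_on with
  | H c =>
    obtain ⟨ch, hch⟩ := exists_cocycle_extension hφ hA hκH hc c
    refine ⟨QuotientGroup.mk ch, ?_⟩
    change (QuotientGroup.mk (ContH1.comapCocycle φ A κ hκ h ch) : ContH1 (φ.comp κ) A H) =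
      QuotientGroup.mk c
    congr 1
    apply Subtype.ext
    funext y
    have hy : (⟨κ y.1, h ⟨y.1, y.2, rfl⟩⟩ : Hh) = κH y := Subtype.ext (hκH y).symm
    show ch.1 ⟨κ y.1, h ⟨y.1, y.2, rfl⟩⟩ = c.1 y
    rw [hy, hch]

/-- **Continuous `H¹` is carried bijectively along a profinite completion** ([EtTh] Rmk. 1.6.4
"determines, by profinite completion"): for `κ_H : H → Ĥ` a profinite completion co-restricting a
continuous `κ : G → Ĝ`, `φ : Ĝ → Ĝ′` continuous into a profinite `Ĝ′`, `A ⊴ Ĝ′` closed abelian normal,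
the pull-back `ContH1.comap φ A κ : H¹(Ĥ, A) → H¹(H, A)` is a bijection.
[cite: MochizukiEtTh2009, Rmk 1.6.4 p.252] [cite: NeukirchSchmidtWingberg2008, I §2 and II §7] -/
theorem comap_bijective_of_isProfiniteCompletion (hφ : Continuous φ) (hA : IsClosed (A : Set Gh'))
    (hκ : Continuous κ) (h : H.map κ ≤ Hh) (hκH : ∀ y : H, ((κH y : Hh) : Gh) = κ (y : G))
    (hc : IsProfiniteCompletion κH) :
    Function.Bijective (ContH1.comap φ A κ hκ h) := by
  refine ⟨comap_injective_of_dense φ hφ A κ hκ h ?_, comap_surjective_of_isProfiniteCompletion hφ hA hκ h hκH hc⟩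
  -- dense image: the range of `κ_H` is `val⁻¹(κ(H))`
  have hr : Set.range κH = (Subtype.val : Hh → Gh) ⁻¹' (κ '' (H : Set G)) := by
    ext w
    constructor
    · rintro ⟨y, rfl⟩
      exact ⟨y, y.2, (hκH y).symm⟩
    · rintro ⟨z, hz, hzw⟩
      refine ⟨⟨z, hz⟩, Subtype.ext ?_⟩
      rw [hκH]; exact hzw
  rw [← hr]
  exact hc.denseRange

end Surjective

end ContH1

end Literature.AnabelianGeometry.EtaleTheta

end
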